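import Mathlib
import Literature.NumberTheory.Transcendental.LandauDefectLatticeTate
import Literature.RingTheory.PowerSeries.LaurentSeriesDerivation
import Summits.KontsevichZagierPeriods.KontsevichZagierPeriods.Theorems.InverseLandauInverseLandauRationalCurvesKernelBase
import Summits.KontsevichZagierPeriods.KontsevichZagierPeriods.Theorems.InverseLandauInverseLandauRationalCurvesKernelDeriv
import Summits.KontsevichZagierPeriods.KontsevichZagierPeriods.Theorems.InverseLandauInverseLandauRationalCurvesKernelTensor
import Summits.KontsevichZagierPeriods.KontsevichZagierPeriods.Theorems.InverseLandauInverseLandauRationalCurvesKernelForms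
import Summits.KontsevichZagierPeriods.KontsevichZagierPeriods.Theorems.InverseLandauInverseLandauRationalCurvesKernelGM

/-!
# Crux `InverseLandauRationalCurves`, line `Sketch` — kernel, VI: the Gauss–Manin module of
vanishing periods

Helpers for the lead's stub `stub_kernel` (item stmt-KontsevichZagierPeriods-13872). For a Tate
family over `K′ ⊇ k(ϖ)` with period functional `I` (see `KernelForms`), the predicate
`InN b a` — "`(b, a)` is the (boundary value, residue vector) of the Hermite data of a Tate form
with vanishing period" — is characterised by `hInN`; we prove that it is closed under `0`, `+`,
scalars (`InN_zero/add/smul`), under the Kummer–Gauss–Manin connection (`InN_nabla`), that it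
misses the constant line (`InN_line`), and the trace-and-order contradiction (`InN_one_false`).
-/

noncomputable section

open Polynomial TensorProduct
open scoped LaurentSeries RatFunc
open Literature.NumberTheory.Transcendental.AyoubRel

namespace Summit.KontsevichZagierPeriods.InverseLandau.RationalCurves

section Module

variable {k : Type*} [Field k] (T : TateFamily₁ k) {K' : Type*} [Field K'] [Algebra k K']
  [Algebra (RatFunc k) K']
  (J : ℕ → ℕ → k⸨X⸩) (I : ℕ → (K'[X] →ₗ[K'] K' ⊗[RatFunc k] k⸨X⸩))
  (hI : ∀ (m i : ℕ) (a : K'), I m (monomial i a) = a ⊗ₜ J i m)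
  (hJa : ∀ i m : ℕ, ∑ l ∈ (T.Q.eval₂ (mapRingHom (C : k →+* k[X])) (C X)).support,
    (((T.Q.eval₂ (mapRingHom (C : k →+* k[X])) (C X)).coeff l : PowerSeries k) : k⸨X⸩) *
      J (i + l) (m + 1) = J i m)
  (dz : Derivation k (RatFunc K') (RatFunc K'))
  (hdz : ∀ p : K'[X], dz (algebraMap K'[X] (RatFunc K') p) =
    algebraMap K'[X] (RatFunc K') (derivative p))
  {ι : Type*} [Fintype ι] (pt : ι → K')
  (InN : K' → (ι → K') → Prop)
  (hInN : ∀ (b : K') (a : ι → K'), InN b a ↔ ∃ (N : K'[X]) (m : ℕ) (M : K'[X]) (n : ℕ),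
    I m N = 0 ∧
    algebraMap K'[X] (RatFunc K') N / algebraMap K'[X] (RatFunc K')
        ((TateFamily₁.toParamPoly T.Q).map (algebraMap (RatFunc k) K') ^ m) =
      dz (algebraMap K'[X] (RatFunc K') M / algebraMap K'[X] (RatFunc K')
        ((TateFamily₁.toParamPoly T.Q).map (algebraMap (RatFunc k) K') ^ n)) +
      ∑ i, RatFunc.C (a i) * (RatFunc.X - RatFunc.C (pt i))⁻¹ ∧
    b = M.eval 1 / ((TateFamily₁.toParamPoly T.Q).map (algebraMap (RatFunc k) K')).eval 1 ^ n -
      M.eval 0 / ((TateFamily₁.toParamPoly T.Q).map (algebraMap (RatFunc k) K')).eval 0 ^ n)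

omit [Fintype ι] in
/-- Adding fractions with a common base of denominators: `(x₁·y^{m₂} + x₂·y^{m₁})/y^{m₁+m₂} =
x₁/y^{m₁} + x₂/y^{m₂}`. -/
theorem div_pow_add_div_pow {F : Type*} [Field F] (x₁ x₂ y : F) (hy : y ≠ 0) (m₁ m₂ : ℕ) :
    (x₁ * y ^ m₂ + x₂ * y ^ m₁) / y ^ (m₁ + m₂) = x₁ / y ^ m₁ + x₂ / y ^ m₂ := by
  rw [div_add_div _ _ (pow_ne_zero _ hy) (pow_ne_zero _ hy), pow_add]
  congr 1
  ring

omit [Algebra k K'] in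
/-- The image of `Q_{K′}` in `K′(z)` is non-zero. -/
theorem algebraMap_QK_ne_zero :
    algebraMap K'[X] (RatFunc K') ((TateFamily₁.toParamPoly T.Q).map (algebraMap (RatFunc k) K'))
      ≠ 0 := by
  rw [map_ne_zero_iff _ (IsFractionRing.injective K'[X] (RatFunc K')),
    Polynomial.map_ne_zero_iff (algebraMap (RatFunc k) K').injective]
  intro h
  have := eval_toParamPoly_algebraMap (k := k) T.Q 0
  rw [h, eval_zero] at this
  exact (map_ne_zero_iff _ (IsFractionRing.injective k[X] (RatFunc k))).2
    (Q_map_evalRingHom_ne_zero T 0) this.symm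

include hInN in
/-- `InN 0 0`: the zero form. -/
theorem InN_zero : InN 0 0 := by
  rw [hInN]
  refine ⟨0, 0, 0, 0, map_zero _, ?_, ?_⟩
  · simp only [map_zero, zero_div, Pi.zero_apply, zero_mul, Finset.sum_const_zero, add_zero]
  · simp only [eval_zero, zero_div, sub_self]

include hI hJa hInN in
/-- `InN` is closed under addition: add the Tate forms over a common power of `Q_{K′}`. -/
theorem InN_add {b₁ b₂ : K'} {a₁ a₂ : ι → K'} (h₁ : InN b₁ a₁) (h₂ : InN b₂ a₂) :
    InN (b₁ + b₂) (a₁ + a₂) := by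
  rw [hInN] at h₁ h₂ ⊢
  obtain ⟨N₁, m₁, M₁, n₁, hI₁, hH₁, hb₁⟩ := h₁
  obtain ⟨N₂, m₂, M₂, n₂, hI₂, hH₂, hb₂⟩ := h₂
  set QK := (TateFamily₁.toParamPoly T.Q).map (algebraMap (RatFunc k) K') with hQK
  have hQ : algebraMap K'[X] (RatFunc K') QK ≠ 0 := algebraMap_QK_ne_zero T
  have hQ0 : QK.eval 0 ≠ 0 := eval_zero_QK_ne_zero T
  have hQ1 : QK.eval 1 ≠ 0 := eval_one_QK_ne_zero T
  refine ⟨N₁ * QK ^ m₂ + N₂ * QK ^ m₁, m₁ + m₂, M₁ * QK ^ n₂ + M₂ * QK ^ n₁, n₁ + n₂, ?_, ?_, ?_⟩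
  · rw [map_add, period_mul_QK_pow T J I hI hJa m₁ m₂ N₁, add_comm m₁ m₂,
      period_mul_QK_pow T J I hI hJa m₂ m₁ N₂, hI₁, hI₂, add_zero]
  · have eN : algebraMap K'[X] (RatFunc K') (N₁ * QK ^ m₂ + N₂ * QK ^ m₁) /
        algebraMap K'[X] (RatFunc K') (QK ^ (m₁ + m₂)) =
        algebraMap K'[X] (RatFunc K') N₁ / algebraMap K'[X] (RatFunc K') (QK ^ m₁) +
          algebraMap K'[X] (RatFunc K') N₂ / algebraMap K'[X] (RatFunc K') (QK ^ m₂) := by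
      simp only [map_add, map_mul, map_pow]
      exact div_pow_add_div_pow _ _ _ hQ m₁ m₂
    have eM : algebraMap K'[X] (RatFunc K') (M₁ * QK ^ n₂ + M₂ * QK ^ n₁) /
        algebraMap K'[X] (RatFunc K') (QK ^ (n₁ + n₂)) =
        algebraMap K'[X] (RatFunc K') M₁ / algebraMap K'[X] (RatFunc K') (QK ^ n₁) +
          algebraMap K'[X] (RatFunc K') M₂ / algebraMap K'[X] (RatFunc K') (QK ^ n₂) := by
      simp only [map_add, map_mul, map_pow]
      exact div_pow_add_div_pow _ _ _ hQ n₁ n₂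
    rw [eN, eM, map_add, hH₁, hH₂]
    simp only [Pi.add_apply, map_add, add_mul, Finset.sum_add_distrib]
    abel
  · rw [hb₁, hb₂, eval_add, eval_mul, eval_mul, eval_pow, eval_pow, eval_add, eval_mul, eval_mul,
      eval_pow, eval_pow, div_pow_add_div_pow _ _ _ hQ1, div_pow_add_div_pow _ _ _ hQ0]
    abel

include hInN hdz in
/-- `InN` is closed under scalars. -/
theorem InN_smul {b : K'} {a : ι → K'} (h : InN b a) (c : K') : InN (c * b) (c • a) := by
  rw [hInN] at h ⊢
  obtain ⟨N, m, M, n, hIN, hH, hb⟩ := h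
  refine ⟨c • N, m, c • M, n, by rw [map_smul, hIN, smul_zero], ?_, ?_⟩
  · rw [Polynomial.smul_eq_C_mul, Polynomial.smul_eq_C_mul, map_mul, map_mul, RatFunc.algebraMap_C,
      mul_div_assoc, mul_div_assoc, Derivation.leibniz, dz_C dz hdz, smul_zero, add_zero, smul_eq_mul,
      hH, mul_add, Finset.mul_sum]
    congr 1
    refine Finset.sum_congr rfl fun i _ => ?_
    rw [Pi.smul_apply, smul_eq_mul, map_mul, mul_assoc]
  · rw [hb, eval_smul, eval_smul, smul_eq_mul, smul_eq_mul, mul_sub, mul_div_assoc, mul_div_assoc]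


variable (D : Derivation k K' K') (dc : Derivation k (RatFunc K') (RatFunc K'))
  (hdc : ∀ p : K'[X], dc (algebraMap K'[X] (RatFunc K') p) =
    algebraMap K'[X] (RatFunc K') (p.sum fun j a => monomial j (D a)))
  (DL : K' ⊗[RatFunc k] k⸨X⸩ →+ K' ⊗[RatFunc k] k⸨X⸩)
  (hDL : ∀ (x : K') (y : k⸨X⸩), DL (x ⊗ₜ y) = D x ⊗ₜ y + x ⊗ₜ LaurentSeries.derivative k y)
  (hJb : ∀ i m : ℕ, LaurentSeries.derivative k (J i m) =
    -(m : k⸨X⸩) * ∑ l ∈ (T.Q.eval₂ (mapRingHom (C : k →+* k[X])) (C X)).support,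
      ((derivative ((T.Q.eval₂ (mapRingHom (C : k →+* k[X])) (C X)).coeff l) : PowerSeries k) :
        k⸨X⸩) * J (i + l) (m + 1))
  (hDQ : ((TateFamily₁.toParamPoly T.Q).map (algebraMap (RatFunc k) K')).sum
      (fun j a => monomial j (D a)) =
    ∑ l ∈ (T.Q.eval₂ (mapRingHom (C : k →+* k[X])) (C X)).support,
      C (algebraMap (RatFunc k) K' (algebraMap k[X] (RatFunc k)
        (derivative ((T.Q.eval₂ (mapRingHom (C : k →+* k[X])) (C X)).coeff l)))) * X ^ l)
  (hroot : ∀ i, ((TateFamily₁.toParamPoly T.Q).map (algebraMap (RatFunc k) K')).IsRoot (pt i))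

include hI hJa hdz hInN hdc hDL hJb hDQ hroot in
/-- **`InN` is stable under the Kummer–Gauss–Manin connection**
`∇(b, a) = (Db + Σᵢ aᵢ·Dgᵢ/gᵢ, Da)`, `gᵢ = (pᵢ - 1)/pᵢ`: differentiate the Tate form in `ϖ`
(its period stays `0` by `D_𝕃 ∘ I = I ∘ d/dϖ`), transform its Hermite data by the horizontality
step, and read off the new boundary value by the boundary step. -/
theorem InN_nabla {b : K'} {a : ι → K'} (h : InN b a) :
    InN (D b + ∑ i, a i * ((((pt i) - 1) / pt i)⁻¹ * D (((pt i) - 1) / pt i)))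
      (fun i => D (a i)) := by
  rw [hInN] at h ⊢
  obtain ⟨N, m, M, n, hIN, hH, hb⟩ := h
  set QK := (TateFamily₁.toParamPoly T.Q).map (algebraMap (RatFunc k) K') with hQK
  have hQne : QK ≠ 0 := fun h => algebraMap_QK_ne_zero (K' := K') T (by
    change algebraMap K'[X] (RatFunc K') QK = 0; rw [h, map_zero])
  have hQ0 : QK.eval 0 ≠ 0 := eval_zero_QK_ne_zero T
  have hQ1 : QK.eval 1 ≠ 0 := eval_one_QK_ne_zero T
  -- the new Tate form and Hermite data
  set QKD : K'[X] := ∑ l ∈ (T.Q.eval₂ (mapRingHom (C : k →+* k[X])) (C X)).support,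
      C (algebraMap (RatFunc k) K' (algebraMap k[X] (RatFunc k)
        (derivative ((T.Q.eval₂ (mapRingHom (C : k →+* k[X])) (C X)).coeff l)))) * X ^ l with hQKD
  set N' : K'[X] := N.sum (fun i a => monomial i (D a)) * QK - m • (N * QKD) with hN'
  set M' : K'[X] := (M.sum fun j b => monomial j (D b)) * QK -
      n • (M * QK.sum fun j b => monomial j (D b)) -
      (∑ i, (a i * D (pt i)) • (QK /ₘ (X - C (pt i)))) * QK ^ n with hM'
  refine ⟨N', m + 1, M', n + 1, ?_, ?_, ?_⟩
  · -- the period of the derived form vanishes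
    have := period_deriv T J I hI D DL hDL (map_zero D) (fun x y => map_add D x y) hJa hJb m N
    rw [hIN, map_zero] at this
    exact this.symm
  · -- horizontality
    have step := gaussManin_step D dc dz hdc hdz pt a _ _ hH
    rw [dcoeff_div_pow D dc hdc N QK hQne m, hDQ] at step
    rw [step]
    congr 2
    rw [dcoeff_div_pow D dc hdc M QK hQne n]
    have e : ∀ i ∈ (Finset.univ : Finset ι),
        RatFunc.C (a i * D (pt i)) * (RatFunc.X - RatFunc.C (pt i))⁻¹ =
          algebraMap K'[X] (RatFunc K') ((a i * D (pt i)) • (QK /ₘ (X - C (pt i))) * QK ^ n) /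
            algebraMap K'[X] (RatFunc K') (QK ^ (n + 1)) := fun i _ =>
      polar_eq_div_pow QK hQne (hroot i) _ n
    rw [Finset.sum_congr rfl e, ← Finset.sum_div, ← map_sum, ← sub_div, ← map_sub, hM',
      Finset.sum_mul]
  · -- the boundary value
    rw [hb]
    exact (boundary_step D pt a QK M n hQ0 hQ1 hroot M' hM').symm

include hI hJa hdz hInN in
/-- **`InN` misses the constant line**: an exact Tate form `(M/Qⁿ)′` with vanishing period has
boundary value `[M/Qⁿ]₀¹ = 0` (termwise fundamental theorem of calculus, and injectivity of
`x ↦ x ⊗ 1`). -/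
theorem InN_line
    (hJc : ∀ i n : ℕ, (i : k⸨X⸩) * J (i - 1) n -
        (n : k⸨X⸩) * ∑ l ∈ (derivative (T.Q.eval₂ (mapRingHom (C : k →+* k[X])) (C X))).support,
          (((derivative (T.Q.eval₂ (mapRingHom (C : k →+* k[X])) (C X))).coeff l :
            PowerSeries k) : k⸨X⸩) * J (i + l) (n + 1) =
        ((algebraMap (Polynomial k) (RatFunc k) (T.Q.map (evalRingHom 1)))⁻¹ ^ n : RatFunc k) -
          (if i = 0 then
            (((algebraMap (Polynomial k) (RatFunc k) (T.Q.map (evalRingHom 0)))⁻¹ ^ n :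
              RatFunc k) : k⸨X⸩) else 0))
    {b : K'} (h : InN b 0) : b = 0 := by
  rw [hInN] at h
  obtain ⟨N, m, M, n, hIN, hH, hb⟩ := h
  set QK := (TateFamily₁.toParamPoly T.Q).map (algebraMap (RatFunc k) K') with hQK
  have hQ : algebraMap K'[X] (RatFunc K') QK ≠ 0 := algebraMap_QK_ne_zero T
  have hQne : QK ≠ 0 := fun h => hQ (by rw [h, map_zero])
  simp only [Pi.zero_apply, map_zero, zero_mul, Finset.sum_const_zero, add_zero] at hH
  rw [dz_div_pow dz hdz M QK hQne n, map_pow, map_pow, div_eq_div_iff (pow_ne_zero _ hQ)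
    (pow_ne_zero _ hQ), ← map_pow, ← map_pow, ← map_mul, ← map_mul] at hH
  have hcross := IsFractionRing.injective K'[X] (RatFunc K') hH
  have key := period_eq_of_cross_mul T J I hI hJa hcross
  rw [hIN, period_ftc T J I hI hJa hJc n M] at key
  rw [hb]
  exact eq_zero_of_tmul_one_eq_zero _ key.symm


include hI hJa hdz hInN hroot in
/-- **Trace-and-order**: `InN 1 a` is impossible when the loop numerator `Σᵢ aᵢ · Q_{K′}/(z - pᵢ)`
has coefficients of valuation `< 1` at every place over `ϖ = 0` (e.g. `aᵢ` constants): the period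
of the loop form would be `-(1 ⊗ 1)`, but `Tr ⊗ id` of it has positive `ϖ`-order while
`Tr 1 = [K′ : k(ϖ)] ≠ 0`. -/
theorem InN_one_false [CharZero k] [IsScalarTower k (RatFunc k) K']
    [FiniteDimensional (RatFunc k) K'] [IsGalois (RatFunc k) K']
    (hJc : ∀ i n : ℕ, (i : k⸨X⸩) * J (i - 1) n -
        (n : k⸨X⸩) * ∑ l ∈ (derivative (T.Q.eval₂ (mapRingHom (C : k →+* k[X])) (C X))).support,
          (((derivative (T.Q.eval₂ (mapRingHom (C : k →+* k[X])) (C X))).coeff l :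
            PowerSeries k) : k⸨X⸩) * J (i + l) (n + 1) =
        ((algebraMap (Polynomial k) (RatFunc k) (T.Q.map (evalRingHom 1)))⁻¹ ^ n : RatFunc k) -
          (if i = 0 then
            (((algebraMap (Polynomial k) (RatFunc k) (T.Q.map (evalRingHom 0)))⁻¹ ^ n :
              RatFunc k) : k⸨X⸩) else 0))
    (hJps : ∀ (i m : ℕ) (n : ℤ), n < 0 → (J i m).coeff n = 0)
    (τ : K' ⊗[RatFunc k] k⸨X⸩ →ₗ[RatFunc k] k⸨X⸩)
    (hτ : ∀ (x : K') (y : k⸨X⸩), τ (x ⊗ₜ y) = Algebra.trace (RatFunc k) K' x • y)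
    (hex : ∃ c : Landau.Place k K', c.val (algebraMap (RatFunc k) K' RatFunc.X) < 1)
    {a : ι → K'}
    (hval : ∀ c : Landau.Place k K', c.val (algebraMap (RatFunc k) K' RatFunc.X) < 1 →
      ∀ i₀ : ℕ, c.val ((∑ i, a i • (((TateFamily₁.toParamPoly T.Q).map
        (algebraMap (RatFunc k) K')) /ₘ (X - C (pt i)))).coeff i₀) < 1)
    (h : InN 1 a) : False := by
  rw [hInN] at h
  obtain ⟨N, m, M, n, hIN, hH, hb⟩ := h
  set QK := (TateFamily₁.toParamPoly T.Q).map (algebraMap (RatFunc k) K') with hQK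
  have hQ : algebraMap K'[X] (RatFunc K') QK ≠ 0 := algebraMap_QK_ne_zero T
  have hQne : QK ≠ 0 := fun h => hQ (by rw [h, map_zero])
  set Nω : K'[X] := ∑ i, a i • (QK /ₘ (X - C (pt i))) with hNω
  set Mex : K'[X] := derivative M * QK - n • (M * derivative QK) with hMex
  -- the polar part over the denominator `QK`
  have hpolar : ∑ i, RatFunc.C (a i) * (RatFunc.X - RatFunc.C (pt i))⁻¹ =
      algebraMap K'[X] (RatFunc K') Nω / algebraMap K'[X] (RatFunc K') QK := by
    have e : ∀ i ∈ (Finset.univ : Finset ι), RatFunc.C (a i) * (RatFunc.X - RatFunc.C (pt i))⁻¹ =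
        algebraMap K'[X] (RatFunc K') (a i • (QK /ₘ (X - C (pt i)))) /
          algebraMap K'[X] (RatFunc K') QK := fun i _ => by
      rw [polar_eq_div_pow QK hQne (hroot i) (a i) 0, pow_zero, mul_one, zero_add, pow_one]
    rw [Finset.sum_congr rfl e, ← Finset.sum_div, ← map_sum]
  -- cross-multiplication: `I m N = I (n+1) Mex + I 1 Nω`
  rw [hpolar, dz_div_pow dz hdz M QK hQne n] at hH
  simp only [map_pow] at hH
  rw [div_add_div _ _ (pow_ne_zero _ hQ) hQ,
    div_eq_div_iff (pow_ne_zero _ hQ) (mul_ne_zero (pow_ne_zero _ hQ) hQ)] at hH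
  have hH' : algebraMap K'[X] (RatFunc K') (N * QK ^ (n + 1 + 1)) =
      algebraMap K'[X] (RatFunc K') ((Mex * QK + Nω * QK ^ (n + 1)) * QK ^ m) := by
    simp only [map_mul, map_add, map_pow]
    linear_combination hH
  have hcross := IsFractionRing.injective K'[X] (RatFunc K') hH'
  have key := period_eq_of_cross_mul T J I hI hJa hcross
  rw [hIN, map_add, period_mul_QK T J I hI hJa (n + 1) Mex,
    show n + 1 + 1 = 1 + (n + 1) by ring, period_mul_QK_pow T J I hI hJa 1 (n + 1) Nω,
    period_ftc T J I hI hJa hJc n M, ← hb] at key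
  -- apply `Tr ⊗ id` and take the coefficient of `ϖ⁰`
  have hτkey := congrArg (fun z => (τ z).coeff 0) key
  simp only [map_zero, HahnSeries.coeff_zero, map_add, HahnSeries.coeff_add] at hτkey
  -- the loop period has positive order
  have hloop : (τ (I 1 Nω)).coeff 0 = 0 := by
    rw [Nω.as_sum_support, map_sum, map_sum, HahnSeries.coeff_sum]
    refine Finset.sum_eq_zero fun i _ => ?_
    rw [hI, hτ, Algebra.smul_def]
    refine laurent_coeff_mul_eq_zero _ _ (fun n hn => ?_) (fun n hn => hJps i 1 n hn) le_rfl
    exact laurent_coeff_trace_eq_zero hex _ (fun c hc => hval c hc i) hn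
  -- while `Tr 1 = [K′ : k(ϖ)]`
  have hone : (τ ((1 : K') ⊗ₜ (1 : k⸨X⸩))).coeff 0 = (Module.finrank (RatFunc k) K' : k) := by
    rw [hτ, ← map_one (algebraMap (RatFunc k) K'), Algebra.trace_algebraMap, Nat.smul_one_eq_cast,
      Algebra.smul_def, mul_one, map_natCast]
    rw [← map_natCast (HahnSeries.C (Γ := ℤ) (R := k)), HahnSeries.C_apply, HahnSeries.coeff_single_same]
  rw [hloop, hone, add_zero] at hτkey
  have hpos : 0 < Module.finrank (RatFunc k) K' := Module.finrank_pos
  exact hpos.ne' (Nat.cast_eq_zero.1 hτkey.symm)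

end Module

/-- **Registered sub-goal `kernel_module_pack`** (packaging for the gate): the image of the
Tate denominator in `K′(z)` is non-zero (the file's substance is `InN_zero/add/smul/nabla/line/
one_false`, which ride along). -/
theorem kernel_module_pack : ∀ {k : Type*} [Field k] (T : TateFamily₁ k) {K' : Type*} [Field K']
    [Algebra (RatFunc k) K'],
    algebraMap (Polynomial K') (RatFunc K')
      ((TateFamily₁.toParamPoly T.Q).map (algebraMap (RatFunc k) K')) ≠ 0 :=
  fun T _ _ _ => algebraMap_QK_ne_zero T

end Summit.KontsevichZagierPeriods.InverseLandau.RationalCurves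

end
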